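import Literature.Probability.LatticeModels.VillainGriffithsFirst
import HarnessLib

/-!
# The worm (integer-current) representation of the Villain two-point function on a finite graph:
# `⟨cos(θ_x − θ_y)⟩_κ = Z_κ(δ_x − δ_y)/Z_κ(0)` with `Z_κ(ρ) = ∑_{J : div J = ρ} ∏_e e^{-J_e²/(2κ_e)}`

The duality identity which the named fact
`Literature.Probability.LatticeModels.AizenmanHarelPeledShapiro2021_villainTwoPoint_mono`
(`VillainMonotonicity.lean`, "Use" paragraph) leaves to its users — "by Fourier duality on each edge
(Poisson summation, `villainKernel κ φ = (2πκ)^{-1/2} ∑_{J ∈ ℤ} e^{−J²/(2κ)} e^{iJφ}`) the worm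
ratio `Z_κ(δ_x − δ_y)/Z_κ(0)` of the zero-divergence integer-current model with weights
`∏ exp(−J_e²/(2κ_e))` … equals `villainTwoPoint s t κ x y` on the same graph" — PROVED, for an
arbitrary finite multigraph (vertices `V`, edges `e : ι` from `s e` to `t e`, stiffnesses `κ_e > 0`),
as the free-boundary-condition case of the pinned current expansion
`setIntegral_cos_mul_pinnedWeight_eq_tsum` (`VillainGriffithsFirst.lean`):

* `villainTwoPoint_eq_currentSum_div` —
  `villainTwoPoint s t κ x y = (∑_{J ∈ ℤ^ι} [div J = δ_y − δ_x] ∏_e e^{-J_e²/(2κ_e)}) / (∑_{J} [div J = 0] ∏_e e^{-J_e²/(2κ_e)})`,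
  `(div J)(v) = ∑_e ([t e = v] − [s e = v]) J_e` (Kirchhoff's law with unit source at `y` and sink at
  `x`: written `[x = v] − [y = v] + div J (v) = 0`); the normalisations `(2π)^{|V|} ∏_e (2πκ_e)^{-1/2}`
  of numerator and denominator cancel.

Theorems only; no definition and no named fact is introduced.

## References

* [WallinEtAl1994] M. Wallin, E. Sørensen, S. Girvin, A. P. Young, Phys. Rev. B 49 (1994) 12115,
  §II (integer-current representation of Villain rotors; Poisson formula).
* [FrohlichSpencerCMP1982] J. Fröhlich, T. Spencer, Comm. Math. Phys. 83 (1982) 411–454, §2.1 (i),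
  §2.2 (2.3) (Fourier transformation to the `ℤ`-valued dual model).
* [AizenmanHarelPeledShapiro2021] M. Aizenman, M. Harel, R. Peled, J. Shapiro, arXiv:2110.09498,
  §3.1 (the model), §11.
-/

noncomputable section

open MeasureTheory Filter Finset Set
open scoped Topology BigOperators Real

namespace Literature.Probability.LatticeModels

open Literature.MathematicalPhysics.QuantumFieldTheory

variable {V ι : Type*} [Fintype V] [Fintype ι] [DecidableEq V]

/-- **The worm (integer-current) representation of the Villain two-point function** on a finite
multigraph with stiffnesses `κ_e > 0`:
`⟨cos(θ_x − θ_y)⟩_κ = (∑_{J : [x=v]−[y=v]+div J(v) = 0 ∀v} ∏_e e^{-J_e²/(2κ_e)}) / (∑_{J : div J = 0} ∏_e e^{-J_e²/(2κ_e)})`,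
`div J (v) = ∑_e ([t e = v] − [s e = v]) J_e`. The free-boundary-condition case (all end-points
`some`) of `setIntegral_cos_mul_pinnedWeight_eq_tsum`; the common factor `(2π)^{|V|} ∏_e (2πκ_e)^{-1/2}`
cancels. [cite: WallinEtAl1994, §II] -/
theorem villainTwoPoint_eq_currentSum_div (s t : ι → V) {κ : ι → ℝ} (hκ : ∀ e, 0 < κ e) (x y : V) :
    villainTwoPoint s t κ x y =
      (∑' J : ι → ℤ, if (∀ v : V, ((if x = v then (1 : ℤ) else 0) - (if y = v then 1 else 0)) +
          ∑ e, ((if t e = v then (1 : ℤ) else 0) - (if s e = v then 1 else 0)) * J e = 0)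
        then ∏ e, Real.exp (-((J e : ℝ) ^ 2) / (2 * κ e)) else 0) /
      ∑' J : ι → ℤ, if (∀ v : V, ∑ e, ((if t e = v then (1 : ℤ) else 0) - (if s e = v then 1 else 0)) * J e = 0)
        then ∏ e, Real.exp (-((J e : ℝ) ^ 2) / (2 * κ e)) else 0 := by
  -- the pinned expansion with all end-points free
  have hnum := setIntegral_cos_mul_pinnedWeight_eq_tsum (V := V) (ι := ι)
    (fun e => some (s e)) (fun e => some (t e)) hκ (some x) (some y)
  have hden := setIntegral_cos_mul_pinnedWeight_eq_tsum (V := V) (ι := ι)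
    (fun e => some (s e)) (fun e => some (t e)) hκ none none
  simp only [Option.elim_some, Option.elim_none, Option.some.injEq, sub_self, Real.cos_zero, one_mul,
    reduceCtorEq, if_false, zero_add] at hnum hden
  -- the normalisation constant
  set C : ℝ := ∏ e, (Real.sqrt (2 * π * κ e))⁻¹ with hC
  have hC0 : 0 < C := Finset.prod_pos fun e _ => inv_pos.2 (Real.sqrt_pos.2 (by have := hκ e; positivity))
  have hsplit : ∀ J : ι → ℤ, ∏ e, Real.exp (-((J e : ℝ) ^ 2) / (2 * κ e)) / Real.sqrt (2 * π * κ e) =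
      (∏ e, Real.exp (-((J e : ℝ) ^ 2) / (2 * κ e))) * C := fun J => by
    rw [hC, ← Finset.prod_mul_distrib]
    rfl
  have hif : ∀ (P : Prop) [Decidable P] (J : ι → ℤ),
      (if P then ∏ e, Real.exp (-((J e : ℝ) ^ 2) / (2 * κ e)) / Real.sqrt (2 * π * κ e) else 0) =
        (if P then ∏ e, Real.exp (-((J e : ℝ) ^ 2) / (2 * κ e)) else 0) * C := by
    intro P _ J
    split_ifs
    · exact hsplit J
    · rw [zero_mul]
  have h2π : (0 : ℝ) < (2 * Real.pi) ^ Fintype.card V := by positivity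
  rw [villainTwoPoint]
  unfold villainSpinWeight
  rw [hnum]
  -- the denominator: `∫ w = ∫ cos(0) w`
  have hden' : ∫ θ in angleCube V, ∏ e, villainKernel (κ e) (θ (t e) - θ (s e)) =
      (2 * Real.pi) ^ Fintype.card V * ∑' J : ι → ℤ,
        if (∀ v : V, ∑ e, ((if t e = v then (1 : ℤ) else 0) - (if s e = v then 1 else 0)) * J e = 0)
        then ∏ e, Real.exp (-((J e : ℝ) ^ 2) / (2 * κ e)) / Real.sqrt (2 * π * κ e) else 0 := hden
  rw [hden']
  simp_rw [hif]
  rw [tsum_mul_right, tsum_mul_right, mul_div_mul_left _ _ h2π.ne', mul_div_mul_right _ _ hC0.ne']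

end Literature.Probability.LatticeModels
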